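import Mathlib
import Summits.CriticalPhenomena.CardyFormulaZ2.Theorems.CardyMagicRigidityNestingRigidityFusionBaseCases
import HarnessLib

/-!
# A-priori polynomial UPPER bound on the tower moments, I: the dyadic cells
# (helper [B-up] of line `positive-cone-weight-doubling`, crux `NestingRigidity`)

Crux `Summit.CriticalPhenomena.CardyFormulaZ2.Theses.CardyMagicRigidity.NestingRigidity`
(stmt-CriticalPhenomena-4835), line `positive-cone-weight-doubling`, registered helper
`towerMoment_upper_latticeEnsembles` ([B-up]: `E_δ[w ^ N_0(r,1)] ≤ r ^ (-C)` for every weight `w > 0`,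
both lattices).  For `w > 1` this is an exponential-moment bound with rate `log(1/r)`; the BK
inequality at a fixed aspect ratio only gives a fixed exponential rate, so the loops of the tower are
sorted into THIN cells: every loop surrounding `B̄(0, r/2)` inside `B(0, 2)` passes through a point `z`
with `r/2 < ‖z‖ < 2`, hence within `a` of a centre `c` of the finite family below with `K a ≤ ‖c‖`; as
the loop surrounds `0 ∉ B(c, K a)` it CROSSES the annulus `A(c; a, K a)` of aspect ratio `K` (chosen
later from `w`).  This file is the deterministic geometry of the cells (no probability):

* `TowerMomentUpper.exists_cells`: for `K ≥ 1` and `0 < r ≤ 1/2` there are `B ≤ 4 (8K+1)² log₂(1/r)`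
  cells `(c i, a i)` with `r/(8K) < a i ≤ 1/2` such that every `z` with `r/2 < ‖z‖ < 2` satisfies
  `dist z (c i) ≤ a i` and `K a i ≤ ‖c i‖` for some `i` (dyadic shells `2^{-k} < ‖z‖ ≤ 2^{1-k}`,
  `k < ⌈log₂(1/r)⌉ + 2`, each carrying the square grid of spacing `2^{1-k}/(4K)`; no definition is
  introduced, the grids are written inline);
* `TowerMomentUpper.exists_mem_range_norm`: a loop whose winding interior contains `B̄(0, ρ)` and whose
  trace lies in `B(0, R)` has a trace point `z` with `ρ < ‖z‖ < R`, and its trace is not inside any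
  ball `B(c, b)` with `b ≤ ‖c‖`.
-/

noncomputable section

open Set Metric
open scoped Real BigOperators

namespace Summit.CriticalPhenomena.CardyFormulaZ2.Cruxes.NestingRigidity.PositiveConeWeightDoubling

open Literature.Probability.RandomPlanarGeometry
open Summit.CriticalPhenomena.CardyFormulaZ2.Cruxes.NestingRigidity.RingCloudTomography

namespace TowerMomentUpper

/-! ## Rounding to a square grid -/

/-- Rounding one coordinate to the grid `h ℤ` moves it by at most `h / 2`. -/
theorem abs_sub_mul_round_le {h : ℝ} (hh : 0 < h) (x : ℝ) :
    |x - h * round (x / h)| ≤ h / 2 := by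
  have h1 := abs_sub_round (x / h)
  have e : x - h * round (x / h) = h * (x / h - round (x / h)) := by field_simp
  rw [e, abs_mul, abs_of_pos hh]
  nlinarith

/-- If `|x| ≤ N h` then the grid index `round (x / h)` is at most `N` in absolute value. -/
theorem abs_round_div_le {h : ℝ} (hh : 0 < h) {x : ℝ} {N : ℕ} (hx : |x| ≤ N * h) :
    |round (x / h)| ≤ (N : ℤ) := by
  have h1 : |x / h| ≤ N := by rw [abs_div, abs_of_pos hh, div_le_iff₀ hh]; exact hx
  have h2 := abs_sub_round (x / h)
  have h3 : |(round (x / h) : ℝ)| ≤ N + 1 / 2 := by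
    have := abs_sub_abs_le_abs_sub (round (x / h) : ℝ) (x / h)
    rw [abs_sub_comm] at h2
    linarith
  have h4 : ((|round (x / h)| : ℤ) : ℝ) < (N : ℝ) + 1 := by rw [Int.cast_abs]; linarith
  have h5 : |round (x / h)| < (N : ℤ) + 1 := by exact_mod_cast h4
  omega

/-! ## The dyadic cells -/

/-- **Covering by one shell's grid.**  Every `z` with `2 / 2^n < ‖z‖ < 2` lies in a dyadic shell
`2^{-k} < ‖z‖ ≤ 2^{1-k}` with `k < n`, within the spacing `h = 2^{1-k}/(4K)` of a point `h (P + Q i)`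
of the square grid of that shell (`|P|, |Q| ≤ 4K`), and that grid point has modulus `≥ K h`
(`K ≥ 1`). -/
theorem exists_centre {K : ℕ} (hK : 1 ≤ K) (n : ℕ) {z : ℂ} (hz0 : 2 / 2 ^ n < ‖z‖) (hz2 : ‖z‖ < 2) :
    ∃ (k : ℕ) (P Q : ℤ), k < n ∧ |P| ≤ 4 * K ∧ |Q| ≤ 4 * K ∧
      dist z (((2 / 2 ^ k / (4 * K) : ℝ) : ℂ) * (P + Q * Complex.I)) ≤ 2 / 2 ^ k / (4 * K) ∧
      (K : ℝ) * (2 / 2 ^ k / (4 * K)) ≤ ‖((2 / 2 ^ k / (4 * K) : ℝ) : ℂ) * (P + Q * Complex.I)‖ := by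
  have hK0 : (0 : ℝ) < K := by exact_mod_cast hK
  have hzpos : 0 < ‖z‖ := lt_of_le_of_lt (by positivity) hz0
  -- the shell
  obtain ⟨k, hk1, hk2⟩ := exists_nat_pow_near (x := 2 / ‖z‖) (y := (2 : ℝ))
    (by rw [le_div_iff₀ hzpos]; linarith) one_lt_two
  have hzle : ‖z‖ ≤ 2 / 2 ^ k := by
    rw [le_div_iff₀ (by positivity)]; rw [le_div_iff₀ hzpos] at hk1; linarith
  have hzgt : 2 / 2 ^ k / 2 < ‖z‖ := by
    rw [div_lt_iff₀ hzpos, pow_succ] at hk2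
    rw [div_div, div_lt_iff₀ (by positivity)]; linarith
  have hkn : k < n := by
    by_contra hkn
    push Not at hkn
    have h1 : (2 : ℝ) ^ n ≤ 2 ^ k := pow_le_pow_right₀ one_le_two hkn
    have h2 : 2 / ‖z‖ < 2 ^ n := by
      rw [div_lt_iff₀ hzpos]; rw [div_lt_iff₀ (by positivity)] at hz0; linarith
    linarith
  -- the grid point
  set h : ℝ := 2 / 2 ^ k / (4 * K) with hh
  have hhpos : 0 < h := by positivity
  have hsc : (2 / 2 ^ k : ℝ) = (4 * K : ℕ) * h := by rw [hh]; push_cast; field_simp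
  set P : ℤ := round (z.re / h) with hP
  set Q : ℤ := round (z.im / h) with hQ
  have hPb : |P| ≤ ((4 * K : ℕ) : ℤ) :=
    abs_round_div_le hhpos (((Complex.abs_re_le_norm z).trans hzle).trans hsc.le)
  have hQb : |Q| ≤ ((4 * K : ℕ) : ℤ) :=
    abs_round_div_le hhpos (((Complex.abs_im_le_norm z).trans hzle).trans hsc.le)
  have hdist : dist z ((h : ℂ) * (P + Q * Complex.I)) ≤ h := by
    rw [dist_eq_norm]
    refine (Complex.norm_le_abs_re_add_abs_im _).trans ?_
    have h1 := abs_sub_mul_round_le hhpos z.re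
    have h2 := abs_sub_mul_round_le hhpos z.im
    rw [← hP] at h1; rw [← hQ] at h2
    simp only [Complex.sub_re, Complex.mul_re, Complex.ofReal_re, Complex.add_re, Complex.intCast_re,
      Complex.I_re, mul_zero, Complex.intCast_im, Complex.I_im, mul_one, sub_self, add_zero,
      Complex.ofReal_im, Complex.add_im, Complex.mul_im, zero_add, zero_mul, sub_zero, Complex.sub_im]
    linarith
  refine ⟨k, P, Q, hkn, by exact_mod_cast hPb, by exact_mod_cast hQb, hdist, ?_⟩
  -- the grid point is far from the origin: `‖c‖ ≥ ‖z‖ - h > (2/2^k) / 2 - h ≥ K h`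
  have h1 : ‖z‖ - h ≤ ‖(h : ℂ) * (P + Q * Complex.I)‖ := by
    have := norm_sub_norm_le z ((h : ℂ) * (P + Q * Complex.I))
    rw [← dist_eq_norm] at this; linarith
  have hK1 : (1 : ℝ) ≤ K := by exact_mod_cast hK
  have hsc' : (2 / 2 ^ k : ℝ) = 4 * K * h := by rw [hsc]; push_cast; ring
  have h2 : h ≤ K * h := le_mul_of_one_le_left hhpos.le hK1
  rw [hsc'] at hzgt
  linarith [hzgt, h1, h2]

/-- **The number of shells.**  With `n = ⌈log₂(1/r)⌉ + 2` (`0 < r ≤ 1`): the shells reach below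
`r / 2`, i.e. `2 / 2^n ≤ r / 2`, and `n ≤ log₂(1/r) + 3`. -/
theorem shells_spec {r : ℝ} (hr : 0 < r) (hr1 : r ≤ 1) :
    2 / 2 ^ (⌈Real.logb 2 (1 / r)⌉₊ + 2) ≤ r / 2 ∧
      ((⌈Real.logb 2 (1 / r)⌉₊ + 2 : ℕ) : ℝ) ≤ Real.logb 2 (1 / r) + 3 := by
  have hL0 : 0 ≤ Real.logb 2 (1 / r) := Real.logb_nonneg one_lt_two (by rw [le_div_iff₀ hr]; linarith)
  constructor
  · have h1 : (1 / r : ℝ) ≤ 2 ^ (⌈Real.logb 2 (1 / r)⌉₊ : ℝ) := by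
      calc (1 / r : ℝ) = 2 ^ Real.logb 2 (1 / r) :=
            (Real.rpow_logb two_pos (by norm_num) (by positivity)).symm
        _ ≤ 2 ^ (⌈Real.logb 2 (1 / r)⌉₊ : ℝ) :=
            Real.rpow_le_rpow_of_exponent_le one_le_two (Nat.le_ceil _)
    rw [Real.rpow_natCast] at h1
    rw [pow_add, div_le_div_iff₀ (by positivity) two_pos]
    rw [div_le_iff₀ hr] at h1
    nlinarith [h1]
  · push_cast; linarith [Nat.ceil_lt_add_one hL0]

/-- **The spacings.**  On every shell `k < ⌈log₂(1/r)⌉ + 2` the spacing `2^{1-k}/(4K)` is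
`> r / (8K)` and `≤ 1/2` (`K ≥ 1`, `0 < r ≤ 1`). -/
theorem spacing_bounds {K : ℕ} (hK : 1 ≤ K) {r : ℝ} (hr : 0 < r) (hr1 : r ≤ 1) {k : ℕ}
    (hk : k < ⌈Real.logb 2 (1 / r)⌉₊ + 2) :
    r / (8 * K) < 2 / 2 ^ k / (4 * K) ∧ (2 : ℝ) / 2 ^ k / (4 * K) ≤ 1 / 2 := by
  have hK0 : (0 : ℝ) < K := by exact_mod_cast hK
  have hK1 : (1 : ℝ) ≤ K := by exact_mod_cast hK
  have hL0 : 0 ≤ Real.logb 2 (1 / r) := Real.logb_nonneg one_lt_two (by rw [le_div_iff₀ hr]; linarith)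
  constructor
  · -- `2 ^ k ≤ 2 · 2^⌈log₂(1/r)⌉ < 4 / r`
    have h1 : (2 : ℝ) ^ (⌈Real.logb 2 (1 / r)⌉₊ : ℝ) < 2 ^ (Real.logb 2 (1 / r) + 1) :=
      Real.rpow_lt_rpow_of_exponent_lt one_lt_two (Nat.ceil_lt_add_one hL0)
    rw [Real.rpow_natCast, Real.rpow_add two_pos, Real.rpow_logb two_pos (by norm_num) (by positivity),
      Real.rpow_one] at h1
    have h2 : (2 : ℝ) ^ k ≤ 2 ^ (⌈Real.logb 2 (1 / r)⌉₊ + 1) := pow_le_pow_right₀ one_le_two (by omega)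
    rw [pow_succ] at h2
    rw [div_div, lt_div_iff₀ (by positivity), div_mul_eq_mul_div, div_lt_iff₀ (by positivity)]
    have h3 : (1 / r * 2 : ℝ) = 2 / r := by ring
    rw [h3] at h1
    rw [lt_div_iff₀ hr] at h1
    have h4 : r * 2 ^ k < 4 := by
      have := mul_le_mul_of_nonneg_left h2 hr.le
      nlinarith [this, h1]
    nlinarith [mul_pos hK0 (sub_pos.2 h4)]
  · rw [div_div, div_le_iff₀ (by positivity)]
    have : (1 : ℝ) ≤ 2 ^ k := one_le_pow₀ one_le_two
    nlinarith

/-- **The dyadic cells.**  For an aspect ratio `K ≥ 1` and a base radius `0 < r ≤ 1/2` there is a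
finite family of `B ≤ 4 (8K+1)² log₂(1/r)` cells, centre `c i` and inner radius `a i` with
`r / (8K) < a i ≤ 1/2`, such that every point `z` of the annulus `r/2 < ‖z‖ < 2` lies within `a i` of
a centre with `K a i ≤ ‖c i‖` (so that the ball `B(c i, K a i)` misses the origin): the square grids
of spacing `2^{1-k}/(4K)` on the shells `k < ⌈log₂(1/r)⌉ + 2` (`exists_centre`). -/
theorem exists_cells {K : ℕ} (hK : 1 ≤ K) {r : ℝ} (hr : 0 < r) (hr2 : r ≤ 1 / 2) :
    ∃ (B : ℕ) (c : Fin B → ℂ) (a : Fin B → ℝ),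
      (B : ℝ) ≤ 4 * (8 * K + 1) ^ 2 * Real.logb 2 (1 / r) ∧
      (∀ i, r / (8 * K) < a i ∧ a i ≤ 1 / 2) ∧
      ∀ z : ℂ, r / 2 < ‖z‖ → ‖z‖ < 2 → ∃ i, dist z (c i) ≤ a i ∧ (K : ℝ) * a i ≤ ‖c i‖ := by
  set n := ⌈Real.logb 2 (1 / r)⌉₊ + 2 with hn
  set ι := Fin n × Fin (8 * K + 1) × Fin (8 * K + 1)
  set e := Fintype.equivFin ι with he
  -- centre and inner radius of the cell `(k, p, q)`
  set ctr : ι → ℂ := fun i ↦ ((2 / 2 ^ (i.1 : ℕ) / (4 * K) : ℝ) : ℂ) *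
    ((((i.2.1 : ℕ) : ℤ) - 4 * K : ℤ) + (((i.2.2 : ℕ) : ℤ) - 4 * K : ℤ) * Complex.I) with hctr
  set rad : ι → ℝ := fun i ↦ 2 / 2 ^ (i.1 : ℕ) / (4 * K) with hrad
  obtain ⟨hreach, hcount⟩ := shells_spec hr (by linarith)
  refine ⟨Fintype.card ι, fun j ↦ ctr (e.symm j), fun j ↦ rad (e.symm j), ?_, fun j ↦
    spacing_bounds hK hr (by linarith) (e.symm j).1.2, fun z hz1 hz2 ↦ ?_⟩
  · have hL1 : 1 ≤ Real.logb 2 (1 / r) := by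
      rw [Real.le_logb_iff_rpow_le one_lt_two (by positivity), Real.rpow_one, le_div_iff₀ hr]; linarith
    have hc' : (n : ℝ) ≤ Real.logb 2 (1 / r) + 3 := by rw [hn]; exact hcount
    have h5 : (n : ℝ) ≤ 4 * Real.logb 2 (1 / r) := by linarith
    have h6 : 0 ≤ (8 * (K : ℝ) + 1) * (8 * K + 1) := by positivity
    simp only [ι, Fintype.card_prod, Fintype.card_fin]
    push_cast
    nlinarith [mul_le_mul_of_nonneg_right h5 h6]
  · rw [← hn] at hreach
    obtain ⟨k, P, Q, hkn, hP, hQ, hdist, hfar⟩ := exists_centre hK n (lt_of_le_of_lt hreach hz1) hz2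
    have hP1 := (abs_le.1 hP).1; have hP2 := (abs_le.1 hP).2
    have hQ1 := (abs_le.1 hQ).1; have hQ2 := (abs_le.1 hQ).2
    set i₀ : ι := ⟨⟨k, hkn⟩, ⟨(P + 4 * K).toNat, by omega⟩, ⟨(Q + 4 * K).toNat, by omega⟩⟩ with hi₀
    have e1 : (((((P + 4 * K).toNat : ℕ) : ℤ) - 4 * K : ℤ) : ℂ) = (P : ℂ) := by
      rw [Int.toNat_of_nonneg (by omega)]; push_cast; ring
    have e2 : (((((Q + 4 * K).toNat : ℕ) : ℤ) - 4 * K : ℤ) : ℂ) = (Q : ℂ) := by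
      rw [Int.toNat_of_nonneg (by omega)]; push_cast; ring
    have hc : ctr i₀ = ((2 / 2 ^ k / (4 * K) : ℝ) : ℂ) * (P + Q * Complex.I) := by
      simp only [hctr, hi₀, e1, e2]
    refine ⟨e i₀, ?_⟩
    simp only [Equiv.symm_apply_apply]
    rw [hc]
    exact ⟨hdist, hfar⟩

/-! ## Loops of the tower pass through the annulus and cross the cells -/

/-- A loop whose winding interior contains `B̄(0, ρ)` and whose trace lies in `B(0, R)` has a trace
point `z` with `ρ < ‖z‖ < R` (any trace point: the winding number vanishes on the trace). -/
theorem exists_mem_range_norm (u : UnbasedLoop ℂ) {ρ R : ℝ}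
    (hwind : closedBall (0 : ℂ) ρ ⊆ {z | u.wind z ≠ 0}) (hrange : u.range ⊆ ball (0 : ℂ) R) :
    ∃ z ∈ u.range, ρ < ‖z‖ ∧ ‖z‖ < R := by
  obtain ⟨z, hz⟩ := u.range_nonempty
  refine ⟨z, hz, not_le.1 fun h ↦ hwind (mem_closedBall_zero_iff.2 h) (unbasedLoop_wind_of_mem_range u hz),
    mem_ball_zero_iff.1 (hrange hz)⟩

/-- A loop surrounding the origin is not drawn inside a ball `B(c, b)` missing the origin
(`b ≤ ‖c‖`): its trace meets `ℂ ∖ B(c, b)`. -/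
theorem range_inter_compl_ball_nonempty (u : UnbasedLoop ℂ) {ρ : ℝ} (hρ : 0 ≤ ρ)
    (hwind : closedBall (0 : ℂ) ρ ⊆ {z | u.wind z ≠ 0}) {c : ℂ} {b : ℝ} (hb : b ≤ ‖c‖) :
    (u.range ∩ (ball c b)ᶜ).Nonempty := by
  by_contra h
  have hsub : u.range ⊆ ball c b := fun z hz ↦ by
    by_contra hz'
    exact h ⟨z, hz, hz'⟩
  exact hwind (mem_closedBall_self hρ)
    (unbasedLoop_wind_eq_zero_of_subset_ball u hsub (by rwa [dist_comm, dist_zero_right]))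

end TowerMomentUpper

/-! ## Anchor: the cells in registered form -/

/-- **Anchor (helper toward [B-up] `towerMoment_upper_latticeEnsembles`): the dyadic cells.**  For
`K ≥ 1` and `0 < r ≤ 1/2` there are `B ≤ 4 (8K+1)² log₂(1/r)` cells `(c i, a i)`,
`r/(8K) < a i ≤ 1/2`, such that every `z` with `r/2 < ‖z‖ < 2` is within `a i` of a centre with
`K a i ≤ ‖c i‖` (`TowerMomentUpper.exists_cells`). -/
theorem towerMomentUpper_cells : ∀ (K : ℕ) (r : ℝ), 1 ≤ K → 0 < r → r ≤ 1 / 2 → ∃ (B : ℕ) (c : Fin B → ℂ) (a : Fin B → ℝ), (B : ℝ) ≤ 4 * (8 * K + 1) ^ 2 * Real.logb 2 (1 / r) ∧ (∀ i, r / (8 * K) < a i ∧ a i ≤ 1 / 2) ∧ ∀ z : ℂ, r / 2 < ‖z‖ → ‖z‖ < 2 → ∃ i, dist z (c i) ≤ a i ∧ (K : ℝ) * a i ≤ ‖c i‖ := by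
  intro K r hK hr hr2
  exact TowerMomentUpper.exists_cells hK hr hr2

end Summit.CriticalPhenomena.CardyFormulaZ2.Cruxes.NestingRigidity.PositiveConeWeightDoubling

end
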